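import Summits.BirchSwinnertonDyer.BirchSwinnertonDyer.Theses.LeadingTerm
import Summits.BirchSwinnertonDyer.BirchSwinnertonDyer.Theses.SelmerRank
import Summits.BirchSwinnertonDyer.BirchSwinnertonDyer.Theorems.LeadingTermConsistencyOfItems
import HarnessLib

/-!
# Line `birth` — BC3 birth skeleton for crux `Consistency` (stmt-BirchSwinnertonDyer-16217)

Route `LeadingTerm` (route-BirchSwinnertonDyer-LeadingTerm), crux #2 `Consistency`: for every
elliptic `E/ℚ` (globally minimal `W`), every good ordinary `p ≥ 5`, canonical cyclotomic height
datum `D` and newform `f` of `E`, with `r := rank_ℤ E(ℚ)`: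
`Reg_∞ > 0 ∧ Ω⁺_f > 0 ∧ ∃ q : ℚ, L^{(r)}(E,1) = r!·q·Ω⁺_f·Reg_∞ ∧ [T^r]L_p(f,α)·log_p(γ)^r = q·(1-α⁻¹)²·Reg_p(D)`.

## The skeleton (planner `planner-skel-stmt-BirchSwinnertonDyer-16217-0`, 2026-08-17)

Two NAMED stubs — the promotion-ready split of line `Sketch`'s single stub S2 along the
mathematics (kernel-checked equivalence `diagonalTwoLe_iff_rationality_and_transfer`, landed
p134366 in `Theorems/LeadingTermConsistencyOfItems.lean`):

* `stub_rationality` **(R) BSD-rationality at the algebraic rank, `p`-free**: on the diagonal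
  `r_MW = r_an ≥ 2`, `L^{(r)}(E,1) ∈ ℚ · r! · Ω⁺_f · Reg_∞(E)` (Tate 1974 Conj. 4(b) / Gross, PCMS 18
  (2011) Conj. 2.10 read modulo `ℚ^×`; OPEN in rank `≥ 2` — no Gross–Zagier formula for `L''(E,1)`).
* `stub_transfer` **(T) the `p`-adic Beilinson transfer GIVEN the archimedean constant**: on the
  diagonal `r_MW = r_an ≥ 2`, at every good ordinary `p ≥ 5` and canonical `D`, every `q ∈ ℚ` with
  `L^{(r)}(E,1) = r!·q·Ω⁺_f·Reg_∞` also satisfies `[T^r]L_p·log_p(γ)^r = q·(1-α⁻¹)²·Reg_p(D)`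
  (Burns–Kurihara–Sano, arXiv:1910.07404 Conj. 1.1 / Cor. 1.10 shape; Perrin-Riou 1987 is its
  `r = 1` case; OPEN in rank `≥ 2`, arXiv:2103.11535 p. 2).

`Consistency_of` concludes the crux BY NAME from the two stubs and the route's registered
obligations, exactly as line `Sketch` v4 does with S2: items `SqueezeUBR2` (crux #4, stmt-0145: no
excess cells), `RankLeOne` (support, stmt-16219: the known diagonal slice `r ≤ 1`),
`KatoCorankBound` (support, stmt-18048: Kato Thm 18.4, corank form) and route SelmerRank's
`SelmerRankLB` (stmt-0131) + `SelmerRankSmallImage` (stmt-14418) — the last three empty every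
deficient cell `1 ≤ r_MW < r_an` with `q = 0` (`deficient_coeff_eq_zero_of_items`, landed p133294);
`r_MW = 0` is the tree theorem `leadingTerm_consistency_of_rank_zero`. The composition is the
landed closed theorem `consistency_of_items_of_diagonalTwoLe` (p134196) after
`diagonalTwoLe_iff_rationality_and_transfer.mpr ⟨(R), (T)⟩`; the closed form with the stub
STATEMENTS as explicit hypotheses is the `example` at the end (kernel-checked, no sorry).

Disproof used (Cruxes/Consistency/Disproof.lean, cdisprove cycle 1): both stubs keep the
load-bearing `IsNewformOf W f` (`consistency_false_without_newform`, landed p130747: `f = 0` has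
`Ω⁺_0 = 0`); `stub_transfer` keeps `D.IsCanonical` (near-miss `consistency_false_without_canonical`:
the zero datum forces `[T^{r}]L_p = 0`) and `IsOrdinaryAt W p` (near-miss
`consistency_false_without_ordinary`: `unitRoot = 0`, `padicLFunction f 0 = 0` junk); no
`-- Targets` stub kills are recorded; neither stub is an instance of a landed Negative lemma
(only `ConsistencyFalseWithoutNewform`, which drops the newform guard both stubs carry).

Sorries: exactly two, inside `stub_rationality` and `stub_transfer`; zero elsewhere.
-/

set_option linter.dupNamespace false

namespace Summit.BirchSwinnertonDyer.BirchSwinnertonDyer.Cruxes.Consistency.Birth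

open Summit.BirchSwinnertonDyer.BirchSwinnertonDyer.Theses.LeadingTerm (Consistency RankLeOne
  SqueezeUBR2 KatoCorankBound)
open Summit.BirchSwinnertonDyer.BirchSwinnertonDyer.Theses.SelmerRank (SelmerRankLB
  SelmerRankSmallImage)
open Summit.BirchSwinnertonDyer.BirchSwinnertonDyer.Theorems (consistency_of_items_of_diagonalTwoLe
  diagonalTwoLe_iff_rationality_and_transfer)

/-! ### The two registered stubs -/

/-- Stub **(R)** — BSD-RATIONALITY AT THE ALGEBRAIC RANK (`p`-free): for every elliptic `E/ℚ`
(globally minimal `W`) with newform `f` and `r := rank_ℤ E(ℚ) = ord_{s=1} L(E,s) ≥ 2`, the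
rank-indexed Taylor coefficient is a RATIONAL multiple of `r! · Ω⁺_f · Reg_∞(E)`. Tate's
refined conjecture read modulo `ℚ^×`; open in rank `≥ 2` (no arithmetic avatar of `L''(E,1)`).
[cite: arXiv:1910.07404, Conj. 1.1] -/
theorem stub_rationality :
    ∀ (W : WeierstrassCurve ℚ) [W.IsElliptic] [W.IsGloballyMinimal]
      ⦃N : ℕ⦄ [NeZero N] (f : CuspForm (CongruenceSubgroup.Gamma0 N) 2),
      Literature.NumberTheory.EllipticCurves.ModularForms.IsNewformOf W f →
      2 ≤ W.mordellWeilRank → W.analyticRank = W.mordellWeilRank →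
        ∃ q : ℚ, iteratedDeriv W.mordellWeilRank W.entireLFunction 1 =
          (((W.mordellWeilRank.factorial : ℝ) * (q : ℝ) *
            Literature.NumberTheory.EllipticCurves.ModularForms.plusPeriod f * W.regulator : ℝ) : ℂ) := by
  sorry

/-- Stub **(T)** — THE `p`-ADIC BEILINSON TRANSFER GIVEN THE ARCHIMEDEAN CONSTANT: for every
elliptic `E/ℚ` (globally minimal `W`) with `r := rank_ℤ E(ℚ) = ord_{s=1} L(E,s) ≥ 2`, every good
ordinary `p ≥ 5`, the canonical cyclotomic height datum `D` and the newform `f` of `E`: every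
`q ∈ ℚ` with `L^{(r)}(E,1) = r!·q·Ω⁺_f·Reg_∞(E)` also has
`[T^r]L_p(f,α_p,T)·log_p(γ)^r = q·(1−α_p⁻¹)²·Reg_p(E,D)` (the rank-`≥ 2` `p`-adic Beilinson
formula of Burns–Kurihara–Sano with its rational constant pinned by the archimedean side;
Perrin-Riou's `p`-adic Gross–Zagier is the `r = 1` case). Open in rank `≥ 2`.
[cite: arXiv:1910.07404, Cor. 1.10] -/
theorem stub_transfer :
    ∀ (W : WeierstrassCurve ℚ) [W.IsElliptic] [W.IsGloballyMinimal] (p : ℕ) [Fact p.Prime],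
      5 ≤ p → Literature.NumberTheory.EllipticCurves.IsOrdinaryAt W p →
      ∀ (D : WeierstrassCurve.PAdicHeightData W p), D.IsCanonical →
      ∀ ⦃N : ℕ⦄ [NeZero N] (f : CuspForm (CongruenceSubgroup.Gamma0 N) 2),
        Literature.NumberTheory.EllipticCurves.ModularForms.IsNewformOf W f →
        2 ≤ W.mordellWeilRank → W.analyticRank = W.mordellWeilRank → ∀ q : ℚ,
          iteratedDeriv W.mordellWeilRank W.entireLFunction 1 =
              (((W.mordellWeilRank.factorial : ℝ) * (q : ℝ) *
                Literature.NumberTheory.EllipticCurves.ModularForms.plusPeriod f * W.regulator : ℝ) : ℂ) →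
            PowerSeries.coeff W.mordellWeilRank
                (Literature.NumberTheory.EllipticCurves.padicLFunction f
                  (Literature.NumberTheory.EllipticCurves.unitRoot W p : ℚ_[p])) *
                Literature.NumberTheory.EllipticCurves.padicLog p
                  (Literature.NumberTheory.EllipticCurves.cyclotomicGenerator p) ^ W.mordellWeilRank =
              (q : ℚ_[p]) * (1 - (Literature.NumberTheory.EllipticCurves.unitRoot W p : ℚ_[p])⁻¹) ^ 2 *
                WeierstrassCurve.padicRegulator D := by
  sorry

/-! ### Composition: the crux BY NAME -/

/-- **`Consistency_of` — composition of line `birth`.** From the two stubs (R) `stub_rationality`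
and (T) `stub_transfer` and the registered obligations `SqueezeUBR2` (crux #4), `RankLeOne`
(support), `KatoCorankBound` (support; Kato Thm 18.4 corank form) and route SelmerRank's
`SelmerRankLB`, `SelmerRankSmallImage`, the crux `Consistency` follows BY NAME:
(R) ∧ (T) give S2 (`diagonalTwoLe_iff_rationality_and_transfer`), and S2 with the five items gives
the crux cell by cell (`consistency_of_items_of_diagonalTwoLe`: `r_MW = 0` tree theorem, no excess
cells, diagonal `r = 1` / `r ≥ 2`, deficient cells with `q = 0`). [folklore] -/
theorem Consistency_of (hUB : SqueezeUBR2) (hR1 : RankLeOne) (hKC : KatoCorankBound)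
    (hLB : SelmerRankLB) (hSI : SelmerRankSmallImage) : Consistency :=
  consistency_of_items_of_diagonalTwoLe
    (diagonalTwoLe_iff_rationality_and_transfer.mpr ⟨stub_rationality, stub_transfer⟩)
    hUB hR1 hKC hLB hSI

/-! ### Closed form: the stub STATEMENTS as explicit hypotheses (no sorry anywhere below) -/

/-- `(R) → (T) → SqueezeUBR2 → RankLeOne → KatoCorankBound → SelmerRankLB → SelmerRankSmallImage →
Consistency`, kernel-checked with the stub signatures verbatim as hypotheses. [folklore] -/
example :
    (∀ (W : WeierstrassCurve ℚ) [W.IsElliptic] [W.IsGloballyMinimal]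
      ⦃N : ℕ⦄ [NeZero N] (f : CuspForm (CongruenceSubgroup.Gamma0 N) 2),
      Literature.NumberTheory.EllipticCurves.ModularForms.IsNewformOf W f →
      2 ≤ W.mordellWeilRank → W.analyticRank = W.mordellWeilRank →
        ∃ q : ℚ, iteratedDeriv W.mordellWeilRank W.entireLFunction 1 =
          (((W.mordellWeilRank.factorial : ℝ) * (q : ℝ) *
            Literature.NumberTheory.EllipticCurves.ModularForms.plusPeriod f * W.regulator : ℝ) : ℂ)) →
    (∀ (W : WeierstrassCurve ℚ) [W.IsElliptic] [W.IsGloballyMinimal] (p : ℕ) [Fact p.Prime],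
      5 ≤ p → Literature.NumberTheory.EllipticCurves.IsOrdinaryAt W p →
      ∀ (D : WeierstrassCurve.PAdicHeightData W p), D.IsCanonical →
      ∀ ⦃N : ℕ⦄ [NeZero N] (f : CuspForm (CongruenceSubgroup.Gamma0 N) 2),
        Literature.NumberTheory.EllipticCurves.ModularForms.IsNewformOf W f →
        2 ≤ W.mordellWeilRank → W.analyticRank = W.mordellWeilRank → ∀ q : ℚ,
          iteratedDeriv W.mordellWeilRank W.entireLFunction 1 =
              (((W.mordellWeilRank.factorial : ℝ) * (q : ℝ) *
                Literature.NumberTheory.EllipticCurves.ModularForms.plusPeriod f * W.regulator : ℝ) : ℂ) →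
            PowerSeries.coeff W.mordellWeilRank
                (Literature.NumberTheory.EllipticCurves.padicLFunction f
                  (Literature.NumberTheory.EllipticCurves.unitRoot W p : ℚ_[p])) *
                Literature.NumberTheory.EllipticCurves.padicLog p
                  (Literature.NumberTheory.EllipticCurves.cyclotomicGenerator p) ^ W.mordellWeilRank =
              (q : ℚ_[p]) * (1 - (Literature.NumberTheory.EllipticCurves.unitRoot W p : ℚ_[p])⁻¹) ^ 2 *
                WeierstrassCurve.padicRegulator D) →
    SqueezeUBR2 → RankLeOne → KatoCorankBound → SelmerRankLB → SelmerRankSmallImage → Consistency :=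
  fun hR hT => consistency_of_items_of_diagonalTwoLe
    (diagonalTwoLe_iff_rationality_and_transfer.mpr ⟨hR, hT⟩)

/-! ### No stub is stronger than the crux (each stub is implied by `Consistency`) -/

/-- `Consistency → (R)`: restriction to the diagonal, at any good ordinary `p ≥ 5` with a
canonical datum (both exist: `exists_good_ordinary_prime_holds`, `exists_isCanonical_holds`) —
via `diagonalTwoLe_of_consistency` and the landed equivalence. [folklore] -/
theorem rationality_of_consistency (hC : Consistency) :
    ∀ (W : WeierstrassCurve ℚ) [W.IsElliptic] [W.IsGloballyMinimal]
      ⦃N : ℕ⦄ [NeZero N] (f : CuspForm (CongruenceSubgroup.Gamma0 N) 2),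
      Literature.NumberTheory.EllipticCurves.ModularForms.IsNewformOf W f →
      2 ≤ W.mordellWeilRank → W.analyticRank = W.mordellWeilRank →
        ∃ q : ℚ, iteratedDeriv W.mordellWeilRank W.entireLFunction 1 =
          (((W.mordellWeilRank.factorial : ℝ) * (q : ℝ) *
            Literature.NumberTheory.EllipticCurves.ModularForms.plusPeriod f * W.regulator : ℝ) : ℂ) :=
  (diagonalTwoLe_iff_rationality_and_transfer.mp
    (Summit.BirchSwinnertonDyer.BirchSwinnertonDyer.Theorems.diagonalTwoLe_of_consistency hC)).1

/-- `Consistency → (T)`: the archimedean identity pins `q` (`r!·Ω⁺_f·Reg_∞ ≠ 0`), so the crux's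
`q` is the given one. [folklore] -/
theorem transfer_of_consistency (hC : Consistency) :
    ∀ (W : WeierstrassCurve ℚ) [W.IsElliptic] [W.IsGloballyMinimal] (p : ℕ) [Fact p.Prime],
      5 ≤ p → Literature.NumberTheory.EllipticCurves.IsOrdinaryAt W p →
      ∀ (D : WeierstrassCurve.PAdicHeightData W p), D.IsCanonical →
      ∀ ⦃N : ℕ⦄ [NeZero N] (f : CuspForm (CongruenceSubgroup.Gamma0 N) 2),
        Literature.NumberTheory.EllipticCurves.ModularForms.IsNewformOf W f →
        2 ≤ W.mordellWeilRank → W.analyticRank = W.mordellWeilRank → ∀ q : ℚ,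
          iteratedDeriv W.mordellWeilRank W.entireLFunction 1 =
              (((W.mordellWeilRank.factorial : ℝ) * (q : ℝ) *
                Literature.NumberTheory.EllipticCurves.ModularForms.plusPeriod f * W.regulator : ℝ) : ℂ) →
            PowerSeries.coeff W.mordellWeilRank
                (Literature.NumberTheory.EllipticCurves.padicLFunction f
                  (Literature.NumberTheory.EllipticCurves.unitRoot W p : ℚ_[p])) *
                Literature.NumberTheory.EllipticCurves.padicLog p
                  (Literature.NumberTheory.EllipticCurves.cyclotomicGenerator p) ^ W.mordellWeilRank =
              (q : ℚ_[p]) * (1 - (Literature.NumberTheory.EllipticCurves.unitRoot W p : ℚ_[p])⁻¹) ^ 2 *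
                WeierstrassCurve.padicRegulator D :=
  (diagonalTwoLe_iff_rationality_and_transfer.mp
    (Summit.BirchSwinnertonDyer.BirchSwinnertonDyer.Theorems.diagonalTwoLe_of_consistency hC)).2

end Summit.BirchSwinnertonDyer.BirchSwinnertonDyer.Cruxes.Consistency.Birth
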